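import Mathlib
import Literature.Computability.AlgebraicComplexity.MatrixMultiplicationExponent
import Literature.Computability.AlgebraicComplexity.KroneckerRank

/-!
# MatrixMultiplication / ShapeSubmodularity — `ShapeSubmodular`, sandwichable cells form an up-set in `c`

Route `ShapeSubmodularity`, crux `ShapeSubmodular` (stmt-MatrixMultiplication-15622), line
`registered` (RESHAPE 5), stub `stub_sandwichMono`.

Write `R(x,y,z)` for `n ↦ R⟨n^x, n^y, n^z⟩ = tensorRank (matMulTensor ℂ (n^x) (n^y) (n^z))` and
`L(x,y,z) = max(x+y, y+z, x+z)` for the flattening value of the format `(x,y,z)`.  The unit cell of the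
pair `(1,2)` with meet `M = (a,b,c)`, sides `P = (a+1,b,c)`, `Q = (a,b+1,c)` and join
`J = (a+1,b+1,c)` is SANDWICHABLE when `J` and `M` admit exponents `u`, `u'` (`R(J) = O(n^u)`,
`R(M) = O(n^{u'})`) with `u + u' ≤ L(P) + L(Q)`.  This stub: if `min (a+1) b ≤ c` and
`min a (b+1) ≤ c`, sandwichability of the cell with meet `(a,b,c)` implies sandwichability of the
cell with meet `(a,b,c+1)`.

Proof.  Take the witnesses `u + 1` and `u' + 1`.
* Arithmetic: under the two hypotheses `c` is not strictly below both moving coordinates of `P`,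
  resp. of `Q`, so raising `c` by one raises each of `L(P)`, `L(Q)` by exactly one:
  `L(a+1,b,c+1) + L(a,b+1,c+1) = L(a+1,b,c) + L(a,b+1,c) + 2` (`omega`).
* `O`-bounds: blocking the third dimension by one factor `n`,
  `R⟨k, m, l·n⟩ ≤ n · R⟨k, m, l⟩` (Kronecker product with `⟨1, 1, n⟩`, whose rank is `≤ n` by the
  standard algorithm; Bläser 2013, Lemma 5.8 and p. 24), together with `n^(c+1) = n^c · n`, turns
  `R = O(n^β)` at height `c` into `R' = O(n^{β+1})` at height `c + 1`, for the join and for the meet.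
-/

-- (single-conjunct summit: the namespace repeats MatrixMultiplication)
set_option linter.dupNamespace false

open Filter Asymptotics
open Literature.Computability.AlgebraicComplexity

namespace Summit.MatrixMultiplication.MatrixMultiplication.Theorems.ShapeSubmodular

/-! ## `O`-bookkeeping: one extra factor of `n` -/

/-- One extra factor of `n`: if `R' n ≤ n · R n` and `R = O(n^β)`, then `R' = O(n^{β+1})`.
[folklore] -/
private theorem mono_isBigO_mul (R R' : ℕ → ℕ) (β : ℝ) (h : ∀ n : ℕ, R' n ≤ n * R n)
    (hO : (fun n : ℕ => (R n : ℝ)) =O[atTop] (fun n : ℕ => (n : ℝ) ^ β)) :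
    (fun n : ℕ => (R' n : ℝ)) =O[atTop] (fun n : ℕ => (n : ℝ) ^ (β + 1)) := by
  -- adapted from `Theorems.ShapeSubmodular.cell_isBigO_mul` (stub_cellOfFlatMeet)
  have h1 : (fun n : ℕ => (R' n : ℝ)) =O[atTop] (fun n : ℕ => (R n : ℝ) * (n : ℝ)) := by
    refine IsBigO.of_bound 1 (Eventually.of_forall fun n => ?_)
    rw [one_mul, Real.norm_of_nonneg (Nat.cast_nonneg _), Real.norm_of_nonneg (by positivity)]
    calc (R' n : ℝ) ≤ ((n * R n : ℕ) : ℝ) := by exact_mod_cast h n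
      _ = (R n : ℝ) * n := by push_cast; ring
  have h2 : (fun n : ℕ => (R n : ℝ) * (n : ℝ)) =O[atTop] (fun n : ℕ => (n : ℝ) ^ β * (n : ℝ)) :=
    hO.mul (isBigO_refl _ _)
  have h3 : (fun n : ℕ => (n : ℝ) ^ β * (n : ℝ)) =ᶠ[atTop] (fun n : ℕ => (n : ℝ) ^ (β + 1)) := by
    filter_upwards [eventually_gt_atTop 0] with n hn0
    rw [Real.rpow_add_one (Nat.cast_pos.2 hn0).ne']
  exact (h1.trans h2).trans h3.isBigO

/-! ## Blocking of matrix multiplication ranks in the third dimension -/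

/-- Blocking in the second outer dimension: `R⟨k, m, l·n⟩ ≤ n · R⟨k, m, l⟩` (Kronecker product with
`⟨1, 1, n⟩`, whose rank is `≤ n` by the standard algorithm). [cite: Blaser2013, Lemma 5.8 and p. 24] -/
private theorem mono_rank_mul_right_le (k m l n : ℕ) :
    tensorRank (matMulTensor ℂ k m (l * n)) ≤ n * tensorRank (matMulTensor ℂ k m l) := by
  -- adapted from `Theorems.ShapeSubmodular.cell_rank_mul_mid_le` (stub_cellOfFlatMeet)
  have h := Blaser2013_rank_matMulTensor_mul_le ℂ k m l 1 1 n
  rw [mul_one k, mul_one m] at h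
  calc tensorRank (matMulTensor ℂ k m (l * n))
        ≤ tensorRank (matMulTensor ℂ k m l) * tensorRank (matMulTensor ℂ 1 1 n) := h
    _ ≤ tensorRank (matMulTensor ℂ k m l) * n := by
        refine Nat.mul_le_mul_left _ ?_
        simpa using tensorRank_matMulTensor_le ℂ 1 1 n
    _ = n * tensorRank (matMulTensor ℂ k m l) := mul_comm _ _

/-- Raising the third exponent by one costs one factor of `n`:
`R⟨k, m, n^(c+1)⟩ ≤ n · R⟨k, m, n^c⟩` (`n^(c+1) = n^c · n` and blocking in the second outer
dimension). [cite: Blaser2013, Lemma 5.8 and p. 24] -/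
private theorem mono_rank_pow_succ_le (k m n c : ℕ) :
    tensorRank (matMulTensor ℂ k m (n ^ (c + 1))) ≤ n * tensorRank (matMulTensor ℂ k m (n ^ c)) := by
  rw [pow_succ]
  exact mono_rank_mul_right_le k m (n ^ c) n

/-! ## The stub -/

/-- **Sandwichable cells form an up-set in the fixed coordinate** (stub `stub_sandwichMono` of the
line `registered` of crux `ShapeSubmodular`): if the cell with meet `(a,b,c)` is sandwichable (the
join `R⟨n^(a+1), n^(b+1), n^c⟩ = O(n^u)` and the meet `R⟨n^a, n^b, n^c⟩ = O(n^{u'})` with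
`u + u' ≤ L(a+1,b,c) + L(a,b+1,c)`, `L(x,y,z) = max(x+y, y+z, x+z)`) and `c` is not below the two
moving minima (`min (a+1) b ≤ c`, `min a (b+1) ≤ c`, so that `L(a+1,b,c+1) = L(a+1,b,c) + 1` and
`L(a,b+1,c+1) = L(a,b+1,c) + 1`), then the cell with meet `(a,b,c+1)` is sandwichable, with the
witnesses `u + 1`, `u' + 1`: block the fixed coordinate once on join and meet
(`R⟨k, m, l·n⟩ ≤ n · R⟨k, m, l⟩`, `Blaser2013_rank_matMulTensor_mul_le` + `tensorRank_matMulTensor_le`).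
[folklore] -/
theorem stub_sandwichMono :
    ∀ a b c : ℕ, min (a + 1) b ≤ c → min a (b + 1) ≤ c →
      (∃ u u' : ℝ,
        u + u' ≤ ((max (a + 1 + b) (max (b + c) (a + 1 + c)) + max (a + (b + 1)) (max (b + 1 + c) (a + c)) : ℕ) : ℝ) ∧
        (fun n : ℕ => (Literature.Computability.AlgebraicComplexity.tensorRank
          (Literature.Computability.AlgebraicComplexity.matMulTensor ℂ
            (n ^ (a + 1)) (n ^ (b + 1)) (n ^ c)) : ℝ))
            =O[Filter.atTop] (fun n : ℕ => (n : ℝ) ^ u) ∧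
        (fun n : ℕ => (Literature.Computability.AlgebraicComplexity.tensorRank
          (Literature.Computability.AlgebraicComplexity.matMulTensor ℂ (n ^ a) (n ^ b) (n ^ c)) : ℝ))
            =O[Filter.atTop] (fun n : ℕ => (n : ℝ) ^ u')) →
      (∃ u u' : ℝ,
        u + u' ≤ ((max (a + 1 + b) (max (b + (c + 1)) (a + 1 + (c + 1))) +
          max (a + (b + 1)) (max (b + 1 + (c + 1)) (a + (c + 1))) : ℕ) : ℝ) ∧
        (fun n : ℕ => (Literature.Computability.AlgebraicComplexity.tensorRank
          (Literature.Computability.AlgebraicComplexity.matMulTensor ℂ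
            (n ^ (a + 1)) (n ^ (b + 1)) (n ^ (c + 1))) : ℝ))
            =O[Filter.atTop] (fun n : ℕ => (n : ℝ) ^ u) ∧
        (fun n : ℕ => (Literature.Computability.AlgebraicComplexity.tensorRank
          (Literature.Computability.AlgebraicComplexity.matMulTensor ℂ (n ^ a) (n ^ b) (n ^ (c + 1))) : ℝ))
            =O[Filter.atTop] (fun n : ℕ => (n : ℝ) ^ u')) := by
  rintro a b c h1 h2 ⟨u, u', hsum, hu, hu'⟩
  -- raising `c` by one raises each of the two flattening values by exactly one
  have hN : (max (a + 1 + b) (max (b + (c + 1)) (a + 1 + (c + 1))) +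
        max (a + (b + 1)) (max (b + 1 + (c + 1)) (a + (c + 1))) : ℕ) =
      (max (a + 1 + b) (max (b + c) (a + 1 + c)) + max (a + (b + 1)) (max (b + 1 + c) (a + c))) + 2 := by
    omega
  refine ⟨u + 1, u' + 1, ?_, ?_, ?_⟩
  · rw [hN]
    push_cast at hsum ⊢
    linarith
  · -- the join: `R⟨n^(a+1), n^(b+1), n^(c+1)⟩ ≤ n · R⟨n^(a+1), n^(b+1), n^c⟩`
    exact mono_isBigO_mul
      (fun n => tensorRank (matMulTensor ℂ (n ^ (a + 1)) (n ^ (b + 1)) (n ^ c)))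
      (fun n => tensorRank (matMulTensor ℂ (n ^ (a + 1)) (n ^ (b + 1)) (n ^ (c + 1)))) u
      (fun n => mono_rank_pow_succ_le _ _ _ _) hu
  · -- the meet: `R⟨n^a, n^b, n^(c+1)⟩ ≤ n · R⟨n^a, n^b, n^c⟩`
    exact mono_isBigO_mul
      (fun n => tensorRank (matMulTensor ℂ (n ^ a) (n ^ b) (n ^ c)))
      (fun n => tensorRank (matMulTensor ℂ (n ^ a) (n ^ b) (n ^ (c + 1)))) u'
      (fun n => mono_rank_pow_succ_le _ _ _ _) hu'

end Summit.MatrixMultiplication.MatrixMultiplication.Theorems.ShapeSubmodular
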